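import Mathlib
import HarnessLib
import Summits.CriticalPhenomena.SAWScalingLimit.Theses.SAWDefectDecoherence
import Summits.CriticalPhenomena.SAWScalingLimit.Theorems.SAWDefectDecoherenceDefectDecoherenceSsReduction
import Summits.CriticalPhenomena.SAWScalingLimit.Theorems.SAWDefectDecoherenceDefectDecoherenceSsSourceDiff
import Summits.CriticalPhenomena.SAWScalingLimit.Theorems.SAWDefectDecoherenceDefectDecoherenceSsSectorLipschitzReduction

/-!
# WEAK FORM of the crux `DefectDecoherence` (stmt-CriticalPhenomena-8549; crux-strategist s5;
companion note `Cruxes/DefectDecoherence/WEAK-FORM.md`)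

`closes` consumes the POINTWISE crux `‖T(v)‖ ≤ C R^{-θ} M(v)` only through the node
`ConjugateClassNegligible`, which needs only the ψ-AVERAGED black-vertex defect `Σ_{b black} ψ_b T(b)`.
With the LANDED identities of the line `sector-slaving` — `stub_tipRegrouping`
(`T = κ (x_c⁻¹ Ā_D + 2 sin(π/24) A_D)`), `stub_sectorRowD` (`Ā_D(v) = rowD(v)`), the a-priori bound
`ss_aprioriArrivalBound` and the zero sums `ss_sum_conj_dartUnit(_sq)` — the averaged defect is EXACTLY

  `Σ_{b ∈ B} ψ_b T(b) = κ (q/x_c) · (X_B − X_W) + κ x_c⁻¹ · Rem`            (`averagedDefect_identity`)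

where `q = slavingCoupling = 2 x_c sin(π/24)`, `X_B = Σ_{b∈B} ψ_b A_D(b)`, `X_W = Σ_{t∈W} ψ_t A_D(t)`
(`W` = the white neighbours of `B`) and `Rem` collects only DISCRETE-GRADIENT terms
`Σ_{b∼t} ē(b,t)^k (ψ_b − ψ_t) · A_ξ(t)` (`k = 1, 2`, sectors `U`, `S`) and `Σ_{b∼t}(ψ_b − ψ_t) · A_D(t)`,
so `‖Rem‖ ≤ osc(ψ) · Σ_t M(t)` with NO rate.  Hence (WEAK-FORM.md (I5): apply the identity at both colours and subtract) the node
is controlled by the STAGGERED ψ-average of the loop-dressed defect `Ā_D − A_D` alone, and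
`ConjugateClassNegligible ⇐ BoundaryWindingRigidity ∧ MassRatio ∧ DressedDefectDecay`
(`conjugateClassNegligible_of_dressedDefectDecay`): the `U`/`S` gradient children and the loop-bound
child of the prepared pointwise split are off the critical path of `closes`.

KERNEL-CHECKED here (axioms propext / Classical.choice / Quot.sound): the colour-agnostic averaged
`D`-row `averaged_viaSum_identity`, the exact identity `averagedDefect_identity`, the rate-free remainder
bound `norm_gradRem_le` (`‖Rem‖ ≤ (3/2) η Σ_{t ∈ W(B)} M(t)`, `η` = oscillation of `ψ` across lattice edges),
their corollary `norm_averagedDefect_sub_staggered_le`, the coefficient identities, the dictionaries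
`staggeredDressedDecay_iff` / `staggeredCleanDecay_iff` (route-item forms) and
`DressedDefectDecay → StaggeredDressedDecay`.  Left `sorry` as the TWO prover targets:
`staggeredCleanDecay_of_staggeredDressedDecay` ((I5) on the lattice: `averaged_viaSum_identity` at both
colours) and `conjugateClassNegligible_of_staggeredCleanDecay` (re-run
`ConjugateClassNegligibleSynthesis.domain_bound` with `averagedDefect_identity` in place of the per-vertex
bound; `--supports stmt-CriticalPhenomena-8551`); the compositions
`conjugateClassNegligible_of_staggeredDressedDecay` / `_of_dressedDefectDecay` are then immediate.
In the identity the white vertices carry the weight `(1/3) Σ_{b ∼ t, b ∈ B} ψ_b` (the average of `ψ` over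
the black neighbours), which differs from `ψ_t` by at most `η` — the form in which the remainder has no
diagonal term.
-/

noncomputable section

open scoped BigOperators ComplexConjugate Classical
open Literature.Probability.LatticeModels Literature.Probability.RandomPlanarGeometry.SAW
open Summit.CriticalPhenomena.SAWScalingLimit.Theorems.DefectDecoherence.TipMartingale
open Summit.CriticalPhenomena.SAWScalingLimit.Theorems.DefectDecoherence.SectorSlaving
open Summit.CriticalPhenomena.SAWScalingLimit.Theses.SAWDefectDecoherence

namespace Summit.CriticalPhenomena.SAWScalingLimit.Cruxes.DefectDecoherence.WeakForm

/-! ### Coefficient identities behind the cancellation -/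

/-- `2 sin(π/24) = q / x_c` (`q = slavingCoupling = 2 x_c sin(π/24)`): the `A_D`-coefficient of the tip
regrouping is `q/x_c`. [folklore] -/
theorem two_sin_eq_coupling_div : 2 * Real.sin (Real.pi / 24) = slavingCoupling / xc := by
  have hxc : (xc : ℝ) ≠ 0 := ne_of_gt hexCriticalFugacity_pos_lt_one.1
  unfold slavingCoupling
  field_simp

/-- `cos(13π/24) = −sin(π/24)` (`13π/24 = π/2 + π/24`). [folklore] -/
theorem cos_thirteen_eq_neg_sin : Real.cos (13 * Real.pi / 24) = -Real.sin (Real.pi / 24) := by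
  rw [show 13 * Real.pi / 24 = Real.pi / 24 + Real.pi / 2 by ring, Real.cos_add_pi_div_two]

/-- The diagonal `D → D` coupling of `rowD`, summed over the three darts, is `−q`:
`3 · (2 x_c cos(13π/24) / 3) = −slavingCoupling`. [folklore] -/
theorem three_mul_rowD_diag : 3 * (2 * xc * Real.cos (13 * Real.pi / 24) / 3) = -slavingCoupling := by
  rw [cos_thirteen_eq_neg_sin]; unfold slavingCoupling; ring

/-- THE cancellation: the `A_D`-coefficient of the tip regrouping and the summed diagonal coupling of the
`D`-row are opposite after the factor `x_c⁻¹`: `x_c⁻¹ · (2 x_c cos(13π/24)) + 2 sin(π/24) = 0`.  This is why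
the clean `D`-average enters the averaged defect only through its STAGGERED part. [folklore] -/
theorem regrouping_coeff_add_rowD_diag :
    xc⁻¹ * (2 * xc * Real.cos (13 * Real.pi / 24)) + 2 * Real.sin (Real.pi / 24) = 0 := by
  have hxc : (xc : ℝ) ≠ 0 := ne_of_gt hexCriticalFugacity_pos_lt_one.1
  rw [cos_thirteen_eq_neg_sin]
  field_simp
  ring

/-! ### Zero sums over the star of a white vertex, seen from its black neighbours -/

/-- `dartUnit b t = −dartUnit t b`. [folklore] -/
theorem dartUnit_swap (b t : HexVertex) : dartUnit b t = -dartUnit t b := by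
  unfold dartUnit
  rw [← neg_sub (hexCenter t) (hexCenter b), norm_neg, neg_div]

/-- `Σ_{b ∈ star Λ t} ē(b,t) = 0` at a `1`-deep `t` (the black neighbours of a white `t` see it along three
unit vectors `120°` apart). [folklore] -/
theorem sum_conj_dartUnit_in (Λ : Finset HexVertex) (t : HexVertex) (ht : Deep Λ t 1) :
    ∑ b ∈ star Λ t, (starRingEnd ℂ) (dartUnit b t) = 0 := by
  have h := ss_sum_conj_dartUnit Λ t ht
  have : ∀ b ∈ star Λ t, (starRingEnd ℂ) (dartUnit b t) = -(starRingEnd ℂ) (dartUnit t b) := by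
    intro b _; rw [dartUnit_swap, map_neg]
  rw [Finset.sum_congr rfl this, Finset.sum_neg_distrib, h, neg_zero]

/-- `Σ_{b ∈ star Λ t} ē(b,t)² = 0` at a `1`-deep `t`. [folklore] -/
theorem sum_conj_dartUnit_sq_in (Λ : Finset HexVertex) (t : HexVertex) (ht : Deep Λ t 1) :
    ∑ b ∈ star Λ t, (starRingEnd ℂ) (dartUnit b t) ^ 2 = 0 := by
  have h := ss_sum_conj_dartUnit_sq Λ t ht
  have : ∀ b ∈ star Λ t, (starRingEnd ℂ) (dartUnit b t) ^ 2 = (starRingEnd ℂ) (dartUnit t b) ^ 2 := by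
    intro b _; rw [dartUnit_swap, map_neg, neg_sq]
  rw [Finset.sum_congr rfl this, h]

/-! ### The averaged objects -/

/-- The white neighbourhood `W(B) = ⋃_{b ∈ B} star Λ b` of a set of (black) vertices. [folklore] -/
def whiteNbhd (Λ : Finset HexVertex) (B : Finset HexVertex) : Finset HexVertex :=
  B.biUnion (star Λ)

/-- Star-weighted test function at `t` seen from `B`: `g_k(t) = Σ_{b ∈ B, t ∈ star Λ b} ē(b,t)^k ψ_b`.
[folklore] -/
def starWeight (Λ : Finset HexVertex) (B : Finset HexVertex) (ψ : HexVertex → ℂ) (k : ℕ)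
    (t : HexVertex) : ℂ :=
  ∑ b ∈ B.filter (fun b => t ∈ star Λ b), (starRingEnd ℂ) (dartUnit b t) ^ k * ψ b

/-- The gradient remainder `Rem` of the averaged `D`-row: `Σ_{t ∈ W(B)} [(1/3) U(t) g₂(t) +
(2x_c cos(5π/24)/3) S(t) g₁(t)]` — only the two PURE-DIFFERENCE star weights `g₁, g₂` enter
(`Σ_{b∼t} ē = Σ_{b∼t} ē² = 0`). [folklore] -/
def gradRem (Λ : Finset HexVertex) (u w : HexVertex) (B : Finset HexVertex) (ψ : HexVertex → ℂ) : ℂ :=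
  ∑ t ∈ whiteNbhd Λ B,
    ((1 / 3 : ℂ) * arrivalSum Λ s(u, w) (rootAngle u w) (-3 / 8) t * starWeight Λ B ψ 2 t +
      ((2 * xc * Real.cos (5 * Real.pi / 24) / 3 : ℝ) : ℂ) *
          arrivalSum Λ s(u, w) (rootAngle u w) (5 / 8) t * starWeight Λ B ψ 1 t)

/-! ### Target 1 — the exact averaged identity (I4 of WEAK-FORM.md) -/

/-- **Averaged `D`-row (kernel-checked, colour-agnostic).**  For any finite set `V` of `2`-deep vertices
and any weight `φ`, the `φ`-weighted sum of the full via-dart `D`-sums `Ā_D` over `V` equals `−q` times the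
clean `D`-character over the neighbourhood `W(V)` weighted by the neighbour-average of `φ`, plus the
pure-gradient remainder: `Σ_{v∈V} φ_v Ā_D(v) = −q Σ_{t∈W(V)} ((1/3)Σ_{v∼t, v∈V} φ_v) A_D(t) + gradRem`.
(`stub_sectorRowD` + `Finset.sum_comm'` + `3·(2x_c cos(13π/24)/3) = −q`.)  This is the building block of
both (I4) and the colour-swap step (I5) of WEAK-FORM.md. [folklore] -/
theorem averaged_viaSum_identity (Λ : Finset HexVertex) (u w : HexVertex) (huw : hexGraph.Adj u w)
    (hu : u ∉ Λ) (hw : w ∈ Λ) (V : Finset HexVertex) (φ : HexVertex → ℂ)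
    (hdeep : ∀ v ∈ V, Deep Λ v 2) :
    ∑ v ∈ V, φ v * viaSum Λ s(u, w) (rootAngle u w) (13 / 8) v =
      -((slavingCoupling : ℝ) : ℂ) *
          ∑ t ∈ whiteNbhd Λ V, ((1 / 3 : ℂ) * starWeight Λ V φ 0 t) *
            arrivalSum Λ s(u, w) (rootAngle u w) (13 / 8) t +
        gradRem Λ u w V φ := by
  set cS : ℂ := ((2 * xc * Real.cos (5 * Real.pi / 24) / 3 : ℝ) : ℂ) with hcS
  set cD : ℂ := ((2 * xc * Real.cos (13 * Real.pi / 24) / 3 : ℝ) : ℂ) with hcD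
  set U : HexVertex → ℂ := fun t => arrivalSum Λ s(u, w) (rootAngle u w) (-3 / 8) t with hU
  set S : HexVertex → ℂ := fun t => arrivalSum Λ s(u, w) (rootAngle u w) (5 / 8) t with hS
  set D : HexVertex → ℂ := fun t => arrivalSum Λ s(u, w) (rootAngle u w) (13 / 8) t with hD
  set W := whiteNbhd Λ V with hW
  -- the D-row at every vertex of V
  have hrow : ∀ v ∈ V, φ v * viaSum Λ s(u, w) (rootAngle u w) (13 / 8) v =
      ∑ t ∈ star Λ v, φ v * ((1 / 3 : ℂ) * (starRingEnd ℂ (dartUnit v t)) ^ 2 * U t +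
        cS * starRingEnd ℂ (dartUnit v t) * S t + cD * D t) := by
    intro v hv
    rw [stub_sectorRowD Λ u w huw hu hw v (hdeep v hv), rowD, Finset.mul_sum]
  -- swap the double sum over the edges between V and W(V)
  have hswap : ∑ v ∈ V, φ v * viaSum Λ s(u, w) (rootAngle u w) (13 / 8) v =
      ∑ t ∈ W, ∑ v ∈ V.filter (fun v => t ∈ star Λ v),
        φ v * ((1 / 3 : ℂ) * (starRingEnd ℂ (dartUnit v t)) ^ 2 * U t +
          cS * starRingEnd ℂ (dartUnit v t) * S t + cD * D t) := by
    rw [Finset.sum_congr rfl hrow]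
    refine Finset.sum_comm' ?_
    intro v t
    rw [hW, whiteNbhd, Finset.mem_biUnion, Finset.mem_filter]
    exact ⟨fun h => ⟨⟨h.1, h.2⟩, v, h.1, h.2⟩, fun h => ⟨h.1.1, h.1.2⟩⟩
  -- pull the characters out of the inner sums
  have hinner : ∀ t, ∑ v ∈ V.filter (fun v => t ∈ star Λ v),
        φ v * ((1 / 3 : ℂ) * (starRingEnd ℂ (dartUnit v t)) ^ 2 * U t +
          cS * starRingEnd ℂ (dartUnit v t) * S t + cD * D t) =
      (1 / 3 : ℂ) * U t * starWeight Λ V φ 2 t + cS * S t * starWeight Λ V φ 1 t +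
        3 * cD * (((1 / 3 : ℂ) * starWeight Λ V φ 0 t) * D t) := by
    intro t
    simp only [starWeight, Finset.mul_sum, Finset.sum_mul, ← Finset.sum_add_distrib]
    refine Finset.sum_congr rfl fun v _ => ?_
    ring
  have hcD3 : 3 * cD = -((slavingCoupling : ℝ) : ℂ) := by
    rw [hcD]
    have := three_mul_rowD_diag
    calc (3 : ℂ) * ((2 * xc * Real.cos (13 * Real.pi / 24) / 3 : ℝ) : ℂ)
        = ((3 * (2 * xc * Real.cos (13 * Real.pi / 24) / 3) : ℝ) : ℂ) := by push_cast; ring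
      _ = ((-slavingCoupling : ℝ) : ℂ) := by rw [this]
      _ = -((slavingCoupling : ℝ) : ℂ) := by push_cast; ring
  have hsum2 : ∑ v ∈ V, φ v * viaSum Λ s(u, w) (rootAngle u w) (13 / 8) v =
      gradRem Λ u w V φ + 3 * cD * ∑ t ∈ W, ((1 / 3 : ℂ) * starWeight Λ V φ 0 t) * D t := by
    rw [hswap, Finset.sum_congr rfl fun t _ => hinner t, gradRem, Finset.mul_sum,
      ← Finset.sum_add_distrib]
  rw [hsum2, hcD3]
  ring

/-- **Averaged defect identity (kernel-checked).**  For a finite set `B` of `2`-deep vertices (the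
black vertices under the support of the test function) and any weight `ψ`, the `ψ`-weighted sum of the
vertex-star defects over `B` equals `κ (q/x_c)` times the STAGGERED weighted clean `D`-character — the
`ψ`-weighted sum over `B` MINUS the sum over the white neighbourhood `W(B)` weighted by the average
`(1/3) Σ_{b ∼ t, b ∈ B} ψ_b` of `ψ` over the black neighbours — plus `κ x_c⁻¹` times the pure-gradient
remainder `gradRem`.  Exact; uses only the LANDED `stub_tipRegrouping`, `stub_sectorRowD`, the swap
`Finset.sum_comm'` and the coefficient identity `x_c⁻¹ · 3 · (2x_c cos(13π/24)/3) = −q/x_c = −2 sin(π/24)`.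
[folklore] -/
theorem averagedDefect_identity (Λ : Finset HexVertex) (u w : HexVertex) (huw : hexGraph.Adj u w)
    (hu : u ∉ Λ) (hw : w ∈ Λ) (B : Finset HexVertex) (ψ : HexVertex → ℂ)
    (hdeep : ∀ b ∈ B, Deep Λ b 2) :
    ∑ b ∈ B, ψ b * defect Λ u w b =
      tipPhase u w * ((slavingCoupling / xc : ℝ) : ℂ) *
          ((∑ b ∈ B, ψ b * arrivalSum Λ s(u, w) (rootAngle u w) (13 / 8) b) -
            ∑ t ∈ whiteNbhd Λ B, ((1 / 3 : ℂ) * starWeight Λ B ψ 0 t) *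
              arrivalSum Λ s(u, w) (rootAngle u w) (13 / 8) t) +
        tipPhase u w * ((xc⁻¹ : ℝ) : ℂ) * gradRem Λ u w B ψ := by
  set κ : ℂ := tipPhase u w with hκ
  set xi : ℂ := ((xc⁻¹ : ℝ) : ℂ) with hxi
  set s2 : ℂ := ((2 * Real.sin (Real.pi / 24) : ℝ) : ℂ) with hs2
  -- Step 1: tip regrouping at every vertex of B
  have step1 : ∀ b ∈ B, ψ b * defect Λ u w b =
      κ * xi * (ψ b * viaSum Λ s(u, w) (rootAngle u w) (13 / 8) b) +
        κ * s2 * (ψ b * arrivalSum Λ s(u, w) (rootAngle u w) (13 / 8) b) := by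
    intro b hb
    have hdeep1 : Deep Λ b 1 := fun y hy => hdeep b hb y (hy.trans (by norm_num))
    obtain ⟨hT, -⟩ := stub_tipRegrouping Λ u w huw hu hw b hdeep1
    rw [hT]
    ring
  have hsum1 : ∑ b ∈ B, ψ b * defect Λ u w b =
      κ * xi * (∑ b ∈ B, ψ b * viaSum Λ s(u, w) (rootAngle u w) (13 / 8) b) +
        κ * s2 * (∑ b ∈ B, ψ b * arrivalSum Λ s(u, w) (rootAngle u w) (13 / 8) b) := by
    rw [Finset.sum_congr rfl step1, Finset.sum_add_distrib, ← Finset.mul_sum, ← Finset.mul_sum]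
  -- Step 2: the averaged D-row and the coefficient identities
  have hs2' : s2 = ((slavingCoupling / xc : ℝ) : ℂ) := by
    rw [hs2, two_sin_eq_coupling_div]
  have hqx : ((slavingCoupling / xc : ℝ) : ℂ) = xi * ((slavingCoupling : ℝ) : ℂ) := by
    rw [hxi]; push_cast; ring
  rw [hsum1, averaged_viaSum_identity Λ u w huw hu hw B ψ hdeep, hs2', hqx]
  ring

/-- Vertices of the white neighbourhood are in `Λ`, `1`-deep, and adjacent to a vertex of `B`.
[folklore] -/
theorem whiteNbhd_facts {Λ : Finset HexVertex} {B : Finset HexVertex} (hdeep : ∀ b ∈ B, Deep Λ b 2)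
    {t : HexVertex} (ht : t ∈ whiteNbhd Λ B) :
    t ∈ Λ ∧ Deep Λ t 1 ∧ ∃ b₀ ∈ B, hexGraph.Adj t b₀ := by
  rw [whiteNbhd, Finset.mem_biUnion] at ht
  obtain ⟨b₀, hb₀, htb⟩ := ht
  obtain ⟨htΛ, hadj⟩ := tip_mem_star.1 htb
  refine ⟨htΛ, ?_, b₀, hb₀, hadj.symm⟩
  intro y hy
  refine hdeep b₀ hb₀ y ?_
  calc dist (hexCenter y) (hexCenter b₀)
      ≤ dist (hexCenter y) (hexCenter t) + dist (hexCenter t) (hexCenter b₀) := dist_triangle _ _ _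
    _ ≤ 1 + 1 := add_le_add hy (dist_hexCenter_le_one_of_adj hadj.symm)
    _ = 2 := by norm_num

/-- Under the support hypothesis, the star weight at `t ∈ W(B)` is the sum over the full star of `t`.
[folklore] -/
theorem starWeight_eq_sum_star {Λ : Finset HexVertex} {B : Finset HexVertex} {ψ : HexVertex → ℂ}
    (hdeep : ∀ b ∈ B, Deep Λ b 2)
    (hsupp : ∀ t ∈ whiteNbhd Λ B, ∀ b ∈ star Λ t, b ∉ B → ψ b = 0)
    {t : HexVertex} (ht : t ∈ whiteNbhd Λ B) (k : ℕ) :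
    starWeight Λ B ψ k t = ∑ b ∈ star Λ t, (starRingEnd ℂ) (dartUnit b t) ^ k * ψ b := by
  obtain ⟨htΛ, -, -⟩ := whiteNbhd_facts hdeep ht
  unfold starWeight
  apply Finset.sum_subset
  · intro b hb
    rw [Finset.mem_filter] at hb
    obtain ⟨hbB, htb⟩ := hb
    have hadj : hexGraph.Adj b t := (tip_mem_star.1 htb).2
    have hbΛ : b ∈ Λ := hdeep b hbB b (by simp)
    exact tip_mem_star.2 ⟨hbΛ, hadj.symm⟩
  · intro b hb hnot
    have hadj : hexGraph.Adj t b := (tip_mem_star.1 hb).2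
    have htb : t ∈ star Λ b := tip_mem_star.2 ⟨htΛ, hadj.symm⟩
    have hbB : b ∉ B := fun hbB => hnot (Finset.mem_filter.2 ⟨hbB, htb⟩)
    rw [hsupp t ht b hb hbB, mul_zero]

/-- `‖ē(b,t)^k‖ ≤ 1`. [folklore] -/
theorem norm_conj_dartUnit_pow_le (b t : HexVertex) (k : ℕ) :
    ‖(starRingEnd ℂ) (dartUnit b t) ^ k‖ ≤ 1 := by
  rw [norm_pow, Complex.norm_conj]
  refine pow_le_one₀ (norm_nonneg _) ?_
  unfold dartUnit
  rw [norm_div, Complex.norm_real, Real.norm_eq_abs, abs_norm]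
  exact div_self_le_one _

/-- The pure-difference star weights are small: `‖g_k(t)‖ ≤ 3η` for `k = 1, 2` when `ψ` oscillates by at
most `η` across the edges at `t`. [folklore] -/
theorem norm_starWeight_le {Λ : Finset HexVertex} {B : Finset HexVertex} {ψ : HexVertex → ℂ} {η : ℝ}
    (hη : 0 ≤ η) (hdeep : ∀ b ∈ B, Deep Λ b 2)
    (hsupp : ∀ t ∈ whiteNbhd Λ B, ∀ b ∈ star Λ t, b ∉ B → ψ b = 0)
    (hosc : ∀ t ∈ whiteNbhd Λ B, ∀ b ∈ star Λ t, ‖ψ b - ψ t‖ ≤ η)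
    {t : HexVertex} (ht : t ∈ whiteNbhd Λ B) {k : ℕ} (hk1 : 1 ≤ k) (hk2 : k ≤ 2) :
    ‖starWeight Λ B ψ k t‖ ≤ 3 * η := by
  obtain ⟨-, hdeep1, b₀, -, hadj₀⟩ := whiteNbhd_facts hdeep ht
  have hzero : ∑ b ∈ star Λ t, (starRingEnd ℂ) (dartUnit b t) ^ k = 0 := by
    interval_cases k
    · simpa using sum_conj_dartUnit_in Λ t hdeep1
    · exact sum_conj_dartUnit_sq_in Λ t hdeep1
  rw [starWeight_eq_sum_star hdeep hsupp ht k]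
  have hrw : ∑ b ∈ star Λ t, (starRingEnd ℂ) (dartUnit b t) ^ k * ψ b =
      ∑ b ∈ star Λ t, (starRingEnd ℂ) (dartUnit b t) ^ k * (ψ b - ψ t) := by
    rw [← sub_eq_zero, ← Finset.sum_sub_distrib]
    have : ∀ b ∈ star Λ t, (starRingEnd ℂ) (dartUnit b t) ^ k * ψ b -
        (starRingEnd ℂ) (dartUnit b t) ^ k * (ψ b - ψ t) = (starRingEnd ℂ) (dartUnit b t) ^ k * ψ t := by
      intro b _; ring
    rw [Finset.sum_congr rfl this, ← Finset.sum_mul, hzero, zero_mul]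
  rw [hrw]
  have hcard : ((star Λ t).card : ℝ) ≤ 3 := by exact_mod_cast slr_card_star_le_three (Λ := Λ) hadj₀
  calc ‖∑ b ∈ star Λ t, (starRingEnd ℂ) (dartUnit b t) ^ k * (ψ b - ψ t)‖
      ≤ ∑ b ∈ star Λ t, ‖(starRingEnd ℂ) (dartUnit b t) ^ k * (ψ b - ψ t)‖ := norm_sum_le _ _
    _ ≤ ∑ b ∈ star Λ t, η := by
        refine Finset.sum_le_sum fun b hb => ?_
        rw [norm_mul]
        calc ‖(starRingEnd ℂ) (dartUnit b t) ^ k‖ * ‖ψ b - ψ t‖ ≤ 1 * η :=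
              mul_le_mul (norm_conj_dartUnit_pow_le b t k) (hosc t ht b hb) (norm_nonneg _) zero_le_one
          _ = η := one_mul η
    _ = (star Λ t).card * η := by rw [Finset.sum_const, nsmul_eq_mul]
    _ ≤ 3 * η := mul_le_mul_of_nonneg_right hcard hη

/-- **Gradient remainder bound (kernel-checked).**  If `ψ` vanishes on black vertices of the stars of
`W(B)` outside `B` and oscillates by at most `η ≥ 0` across the edges at `W(B)`, then
`‖gradRem‖ ≤ (3/2) η · Σ_{t ∈ W(B)} M(t)` (a-priori bound `‖A_ξ‖ ≤ M/2`, `|2x_c cos(5π/24)/3| ≤ 2/3`).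
No rate, no Harnack inequality, no loop bound. [folklore] -/
theorem norm_gradRem_le (Λ : Finset HexVertex) (u w : HexVertex) (huw : hexGraph.Adj u w)
    (hu : u ∉ Λ) (hw : w ∈ Λ) (B : Finset HexVertex) (ψ : HexVertex → ℂ) {η : ℝ} (hη : 0 ≤ η)
    (hdeep : ∀ b ∈ B, Deep Λ b 2)
    (hsupp : ∀ t ∈ whiteNbhd Λ B, ∀ b ∈ star Λ t, b ∉ B → ψ b = 0)
    (hosc : ∀ t ∈ whiteNbhd Λ B, ∀ b ∈ star Λ t, ‖ψ b - ψ t‖ ≤ η) :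
    ‖gradRem Λ u w B ψ‖ ≤ 3 / 2 * η * ∑ t ∈ whiteNbhd Λ B, mass Λ u w t := by
  have hxc : 0 < xc ∧ xc < 1 := hexCriticalFugacity_pos_lt_one
  have hcS : ‖((2 * xc * Real.cos (5 * Real.pi / 24) / 3 : ℝ) : ℂ)‖ ≤ 2 / 3 := by
    rw [Complex.norm_real, Real.norm_eq_abs]
    have hc : |Real.cos (5 * Real.pi / 24)| ≤ 1 := Real.abs_cos_le_one _
    rw [abs_div, abs_mul, abs_mul, abs_of_pos hxc.1, abs_of_pos (by norm_num : (0:ℝ) < 2),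
      abs_of_pos (by norm_num : (0:ℝ) < 3)]
    have : 2 * xc * |Real.cos (5 * Real.pi / 24)| ≤ 2 * 1 * 1 := by
      apply mul_le_mul (by linarith) hc (abs_nonneg _) (by norm_num)
    linarith
  unfold gradRem
  rw [Finset.mul_sum]
  refine (norm_sum_le _ _).trans (Finset.sum_le_sum fun t ht => ?_)
  obtain ⟨-, hdeep1, -⟩ := whiteNbhd_facts hdeep ht
  have hM0 : 0 ≤ mass Λ u w t := mass_nonneg Λ u w t
  have hU : ‖arrivalSum Λ s(u, w) (rootAngle u w) (-3 / 8) t‖ ≤ 1 / 2 * mass Λ u w t :=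
    ss_aprioriArrivalBound Λ u w huw hu hw t hdeep1 _
  have hS : ‖arrivalSum Λ s(u, w) (rootAngle u w) (5 / 8) t‖ ≤ 1 / 2 * mass Λ u w t :=
    ss_aprioriArrivalBound Λ u w huw hu hw t hdeep1 _
  have hg2 : ‖starWeight Λ B ψ 2 t‖ ≤ 3 * η := norm_starWeight_le hη hdeep hsupp hosc ht (by norm_num) le_rfl
  have hg1 : ‖starWeight Λ B ψ 1 t‖ ≤ 3 * η := norm_starWeight_le hη hdeep hsupp hosc ht le_rfl (by norm_num)
  have h3η : 0 ≤ 3 * η := by positivity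
  calc ‖(1 / 3 : ℂ) * arrivalSum Λ s(u, w) (rootAngle u w) (-3 / 8) t * starWeight Λ B ψ 2 t +
          ((2 * xc * Real.cos (5 * Real.pi / 24) / 3 : ℝ) : ℂ) *
            arrivalSum Λ s(u, w) (rootAngle u w) (5 / 8) t * starWeight Λ B ψ 1 t‖
      ≤ ‖(1 / 3 : ℂ) * arrivalSum Λ s(u, w) (rootAngle u w) (-3 / 8) t * starWeight Λ B ψ 2 t‖ +
          ‖((2 * xc * Real.cos (5 * Real.pi / 24) / 3 : ℝ) : ℂ) *
            arrivalSum Λ s(u, w) (rootAngle u w) (5 / 8) t * starWeight Λ B ψ 1 t‖ := norm_add_le _ _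
    _ ≤ 1 / 3 * (1 / 2 * mass Λ u w t) * (3 * η) + 2 / 3 * (1 / 2 * mass Λ u w t) * (3 * η) := by
        apply add_le_add
        · rw [norm_mul, norm_mul]
          have h13 : ‖(1 / 3 : ℂ)‖ = 1 / 3 := by norm_num
          rw [h13]
          apply mul_le_mul (mul_le_mul_of_nonneg_left hU (by norm_num)) hg2 (norm_nonneg _)
          positivity
        · rw [norm_mul, norm_mul]
          apply mul_le_mul (mul_le_mul hcS hS (norm_nonneg _) (by norm_num)) hg1 (norm_nonneg _)
          positivity
    _ = 3 / 2 * η * mass Λ u w t := by ring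

/-- `‖κ‖ ≤ 1` (`κ = tipPhase = −(√3/6) e^{i(5/8)θ_a}`, `‖κ‖ = √3/6`). [folklore] -/
theorem norm_tipPhase_le_one (u w : HexVertex) : ‖tipPhase u w‖ ≤ 1 := by
  unfold tipPhase
  rw [norm_mul, Complex.norm_exp_ofReal_mul_I, mul_one, Complex.norm_real, Real.norm_eq_abs,
    abs_neg, abs_of_nonneg (show (0 : ℝ) ≤ Real.sqrt 3 / 6 by positivity)]
  have h3 : Real.sqrt 3 ≤ 6 := by
    nlinarith [Real.sq_sqrt (show (0 : ℝ) ≤ 3 by norm_num), Real.sqrt_nonneg 3]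
  linarith

/-- **Averaged defect vs staggered clean `D`-character (kernel-checked corollary).**  Under the support
and oscillation hypotheses, the `ψ`-averaged defect over `B` differs from `κ (q/x_c)` times the
staggered weighted clean `D`-character by at most `x_c⁻¹ (3/2) η Σ_{t ∈ W(B)} M(t)` — one factor of the
oscillation `η` of the test function (`η ∼ δ` in the node's setting), NO rate. [folklore] -/
theorem norm_averagedDefect_sub_staggered_le (Λ : Finset HexVertex) (u w : HexVertex)
    (huw : hexGraph.Adj u w) (hu : u ∉ Λ) (hw : w ∈ Λ) (B : Finset HexVertex) (ψ : HexVertex → ℂ)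
    {η : ℝ} (hη : 0 ≤ η) (hdeep : ∀ b ∈ B, Deep Λ b 2)
    (hsupp : ∀ t ∈ whiteNbhd Λ B, ∀ b ∈ star Λ t, b ∉ B → ψ b = 0)
    (hosc : ∀ t ∈ whiteNbhd Λ B, ∀ b ∈ star Λ t, ‖ψ b - ψ t‖ ≤ η) :
    ‖(∑ b ∈ B, ψ b * defect Λ u w b) -
        tipPhase u w * ((slavingCoupling / xc : ℝ) : ℂ) *
          ((∑ b ∈ B, ψ b * arrivalSum Λ s(u, w) (rootAngle u w) (13 / 8) b) -
            ∑ t ∈ whiteNbhd Λ B, ((1 / 3 : ℂ) * starWeight Λ B ψ 0 t) *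
              arrivalSum Λ s(u, w) (rootAngle u w) (13 / 8) t)‖ ≤
      xc⁻¹ * (3 / 2 * η * ∑ t ∈ whiteNbhd Λ B, mass Λ u w t) := by
  rw [averagedDefect_identity Λ u w huw hu hw B ψ hdeep, add_sub_cancel_left, norm_mul, norm_mul,
    Complex.norm_real, Real.norm_eq_abs,
    abs_of_pos (inv_pos.2 hexCriticalFugacity_pos_lt_one.1)]
  have hR := norm_gradRem_le Λ u w huw hu hw B ψ hη hdeep hsupp hosc
  have hxi : 0 ≤ (xc⁻¹ : ℝ) := le_of_lt (inv_pos.2 hexCriticalFugacity_pos_lt_one.1)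
  have hM : 0 ≤ 3 / 2 * η * ∑ t ∈ whiteNbhd Λ B, mass Λ u w t := by
    have := Finset.sum_nonneg fun t (_ : t ∈ whiteNbhd Λ B) => mass_nonneg Λ u w t
    positivity
  calc ‖tipPhase u w‖ * xc⁻¹ * ‖gradRem Λ u w B ψ‖
      ≤ 1 * xc⁻¹ * (3 / 2 * η * ∑ t ∈ whiteNbhd Λ B, mass Λ u w t) := by
        apply mul_le_mul _ hR (norm_nonneg _) (by positivity)
        exact mul_le_mul_of_nonneg_right (norm_tipPhase_le_one u w) hxi
    _ = xc⁻¹ * (3 / 2 * η * ∑ t ∈ whiteNbhd Λ B, mass Λ u w t) := by ring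

/-! ### Target 2 — the weak synthesis: the node from the loop-dressed child alone -/

/-- `DressedDefectDecay` in the line's vocabulary (definitionally the route-item-form child 4 of the
prepared split, `ss_dressedDefectDecay_iff`, landed p143107; = registered stub `stub_dressedDefectDecay`).
[folklore] -/
def DressedDefectDecay : Prop :=
  ∃ C θ : ℝ, 3 / 4 < θ ∧ DecayBound dressedDefect C θ

/-- **Staggered, support-averaged form of the residual** (the weakest lattice-uniform statement the node
needs, `WEAK-FORM.md` (C3)): uniformly over admissible configurations, for a weight `ψ` bounded by `1`,
`L/R`-Lipschitz across lattice edges and supported on a finite set `S` of `R`-deep vertices, the STAGGERED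
(`+` on black, `−` on white) `ψ`-sum of the dressed defect over `S` is `≤ C (1 + L) R^{-θ}` times the
summed star mass of `S`, `θ > 3/4`.  Implied termwise by `DressedDefectDecay`
(`staggeredDressedDecay_of_dressedDefectDecay`); strictly weaker in intent — cancellations across the
support AND between the two sublattices are allowed, and a weight concentrated near one vertex is forced
small by the Lipschitz bound (a bump of radius `ρ` has size `≤ Lρ/R`), so no pointwise rate is implied.
In the node's setting `S` = the black vertices under the support of `ψ(δ·)` together with their white
neighbours, `R = ε/δ`, `L = Lip(ψ)·ε`. [folklore] -/
def StaggeredDressedDecay : Prop :=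
  ∃ C θ : ℝ, 3 / 4 < θ ∧
    ∀ (Λ : Finset HexVertex), hexDomainSimplyConnected Λ →
      ∀ (u w : HexVertex), hexGraph.Adj u w → u ∉ Λ → w ∈ Λ →
        ∀ (S : Finset HexVertex) (ψ : HexVertex → ℂ) (R L : ℝ), 1 ≤ R → 0 ≤ L →
          (∀ v, ψ v ≠ 0 → v ∈ S) → (∀ v ∈ S, Deep Λ v R) → (∀ v, ‖ψ v‖ ≤ 1) →
            (∀ v t : HexVertex, hexGraph.Adj v t → ‖ψ v - ψ t‖ ≤ L / R) →
              ‖∑ v ∈ S, (if v.2 = 0 then (1 : ℂ) else -1) * ψ v * dressedDefect Λ u w v‖ ≤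
                C * (1 + L) * R ^ (-θ) * ∑ v ∈ S, mass Λ u w v

/-- **Staggered clean form** (the statement the averaged identity consumes DIRECTLY, `WEAK-FORM.md` (I4)):
the same with the clean defect character `A_D` in place of the dressing.  By (I5) it follows, up to a
rate-`1` term, from `StaggeredDressedDecay` (`staggeredCleanDecay_of_staggeredDressedDecay`, target below).
[folklore] -/
def StaggeredCleanDecay : Prop :=
  ∃ C θ : ℝ, 3 / 4 < θ ∧
    ∀ (Λ : Finset HexVertex), hexDomainSimplyConnected Λ →
      ∀ (u w : HexVertex), hexGraph.Adj u w → u ∉ Λ → w ∈ Λ →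
        ∀ (S : Finset HexVertex) (ψ : HexVertex → ℂ) (R L : ℝ), 1 ≤ R → 0 ≤ L →
          (∀ v, ψ v ≠ 0 → v ∈ S) → (∀ v ∈ S, Deep Λ v R) → (∀ v, ‖ψ v‖ ≤ 1) →
            (∀ v t : HexVertex, hexGraph.Adj v t → ‖ψ v - ψ t‖ ≤ L / R) →
              ‖∑ v ∈ S, (if v.2 = 0 then (1 : ℂ) else -1) * ψ v * cleanDefect Λ u w v‖ ≤
                C * (1 + L) * R ^ (-θ) * ∑ v ∈ S, mass Λ u w v

/-- **Dictionary, staggered dressed decay**: the ROUTE-ITEM form (spelled over `Literature` declarations,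
ready for `ledger workitem add --signature` / `route edit --restate` by the tenure planner) is definitionally
`StaggeredDressedDecay`. [folklore] -/
theorem staggeredDressedDecay_iff :
    (∃ C θ : ℝ, 3 / 4 < θ ∧ ∀ (Λ : Finset Literature.Probability.LatticeModels.HexVertex), Literature.Probability.RandomPlanarGeometry.SAW.hexDomainSimplyConnected Λ → ∀ (u w : Literature.Probability.LatticeModels.HexVertex), Literature.Probability.LatticeModels.hexGraph.Adj u w → u ∉ Λ → w ∈ Λ → ∀ (S : Finset Literature.Probability.LatticeModels.HexVertex) (ψ : Literature.Probability.LatticeModels.HexVertex → ℂ) (R L : ℝ), 1 ≤ R → 0 ≤ L → (∀ v : Literature.Probability.LatticeModels.HexVertex, ψ v ≠ 0 → v ∈ S) → (∀ v ∈ S, ∀ y : Literature.Probability.LatticeModels.HexVertex, dist (Literature.Probability.LatticeModels.hexCenter y) (Literature.Probability.LatticeModels.hexCenter v) ≤ R → y ∈ Λ) → (∀ v : Literature.Probability.LatticeModels.HexVertex, ‖ψ v‖ ≤ 1) → (∀ v t : Literature.Probability.LatticeModels.HexVertex, Literature.Probability.LatticeModels.hexGraph.Adj v t → ‖ψ v -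 ψ t‖ ≤ L / R) → ‖∑ v ∈ S, (if v.2 = 0 then (1 : ℂ) else -1) * ψ v * ((∑ s ∈ Λ.filter (fun q => Literature.Probability.LatticeModels.hexGraph.Adj v q), ∑ γ : Literature.Probability.RandomPlanarGeometry.SAW.HexMidEdgeSAW Λ s(u, w) s(s, v), (if γ.verts.getLast? = some s then ((Literature.Probability.RandomPlanarGeometry.SAW.hexCriticalFugacity : ℝ) : ℂ) ^ (γ.length + 1) * Complex.exp (-Complex.I * ((13 / 8 : ℝ) : ℂ) * ((Complex.arg (Literature.Probability.LatticeModels.hexCenter w - Literature.Probability.LatticeModels.hexCenter u) + γ.winding : ℝ) : ℂ)) else 0)) - (∑ s ∈ Λ.filter (fun q => Literature.Probability.LatticeModels.hexGraph.Adj v q), ∑ γ : Literature.Probability.RandomPlanarGeometry.SAW.HexMidEdgeSAW Λ s(u, w) s(s, v), (if γ.verts.getLast? = some s ∧ v ∉ γ.verts then ((Literature.Probability.RandomPlanarGeometry.SAW.hexCriticalFugacity : ℝ) : ℂ) ^ (γ.length + 1) * Complex.exp (-Complex.I * ((13 / 8 : ℝ) : ℂ) * ((Complex.arg (Literature.Probability.LatticeModels.hexCenter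 w - Literature.Probability.LatticeModels.hexCenter u) + γ.winding : ℝ) : ℂ)) else 0)))‖ ≤ C * (1 + L) * R ^ (-θ) * ∑ v ∈ S, ∑ t ∈ Λ.filter (fun t => Literature.Probability.LatticeModels.hexGraph.Adj v t), ‖Literature.Probability.RandomPlanarGeometry.SAW.hexParafermionicObservable Λ s(u, w) Literature.Probability.RandomPlanarGeometry.SAW.hexCriticalFugacity 0 s(v, t)‖) ↔ StaggeredDressedDecay :=
  Iff.rfl

/-- **Dictionary, staggered clean decay**: route-item form of `StaggeredCleanDecay`. [folklore] -/
theorem staggeredCleanDecay_iff :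
    (∃ C θ : ℝ, 3 / 4 < θ ∧ ∀ (Λ : Finset Literature.Probability.LatticeModels.HexVertex), Literature.Probability.RandomPlanarGeometry.SAW.hexDomainSimplyConnected Λ → ∀ (u w : Literature.Probability.LatticeModels.HexVertex), Literature.Probability.LatticeModels.hexGraph.Adj u w → u ∉ Λ → w ∈ Λ → ∀ (S : Finset Literature.Probability.LatticeModels.HexVertex) (ψ : Literature.Probability.LatticeModels.HexVertex → ℂ) (R L : ℝ), 1 ≤ R → 0 ≤ L → (∀ v : Literature.Probability.LatticeModels.HexVertex, ψ v ≠ 0 → v ∈ S) → (∀ v ∈ S, ∀ y : Literature.Probability.LatticeModels.HexVertex, dist (Literature.Probability.LatticeModels.hexCenter y) (Literature.Probability.LatticeModels.hexCenter v) ≤ R → y ∈ Λ) → (∀ v : Literature.Probability.LatticeModels.HexVertex, ‖ψ v‖ ≤ 1) → (∀ v t : Literature.Probability.LatticeModels.HexVertex, Literature.Probability.LatticeModels.hexGraph.Adj v t → ‖ψ v - ψ t‖ ≤ L / R) → ‖∑ v ∈ S, (if v.2 = 0 then (1 : ℂ) else -1) * ψ v * (∑ s ∈ Λ.filter (fun q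 => Literature.Probability.LatticeModels.hexGraph.Adj v q), ∑ γ : Literature.Probability.RandomPlanarGeometry.SAW.HexMidEdgeSAW Λ s(u, w) s(s, v), (if γ.verts.getLast? = some s ∧ v ∉ γ.verts then ((Literature.Probability.RandomPlanarGeometry.SAW.hexCriticalFugacity : ℝ) : ℂ) ^ (γ.length + 1) * Complex.exp (-Complex.I * ((13 / 8 : ℝ) : ℂ) * ((Complex.arg (Literature.Probability.LatticeModels.hexCenter w - Literature.Probability.LatticeModels.hexCenter u) + γ.winding : ℝ) : ℂ)) else 0))‖ ≤ C * (1 + L) * R ^ (-θ) * ∑ v ∈ S, ∑ t ∈ Λ.filter (fun t => Literature.Probability.LatticeModels.hexGraph.Adj v t), ‖Literature.Probability.RandomPlanarGeometry.SAW.hexParafermionicObservable Λ s(u, w) Literature.Probability.RandomPlanarGeometry.SAW.hexCriticalFugacity 0 s(v, t)‖) ↔ StaggeredCleanDecay :=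
  Iff.rfl

/-- `DressedDefectDecay → StaggeredDressedDecay` (termwise triangle inequality; the Lipschitz and
support hypotheses are not used). [folklore] -/
theorem staggeredDressedDecay_of_dressedDefectDecay : DressedDefectDecay → StaggeredDressedDecay := by
  rintro ⟨C, θ, hθ, h⟩
  refine ⟨|C|, θ, hθ, ?_⟩
  intro Λ hΛ u w huw hu hw S ψ R L hR hL _hsupp hdeep hψ _hLip
  have hR0 : 0 ≤ R := zero_le_one.trans hR
  calc ‖∑ v ∈ S, (if v.2 = 0 then (1 : ℂ) else -1) * ψ v * dressedDefect Λ u w v‖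
      ≤ ∑ v ∈ S, ‖(if v.2 = 0 then (1 : ℂ) else -1) * ψ v * dressedDefect Λ u w v‖ :=
        norm_sum_le _ _
    _ ≤ ∑ v ∈ S, |C| * R ^ (-θ) * mass Λ u w v := by
        refine Finset.sum_le_sum fun v hv => ?_
        have h1 : ‖(if v.2 = 0 then (1 : ℂ) else -1) * ψ v‖ ≤ 1 := by
          rw [norm_mul]
          have hs : ‖(if v.2 = 0 then (1 : ℂ) else -1)‖ = 1 := by split_ifs <;> simp
          rw [hs, one_mul]; exact hψ v
        have h2 : ‖dressedDefect Λ u w v‖ ≤ |C| * R ^ (-θ) * mass Λ u w v := by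
          refine (h Λ hΛ u w huw hu hw v R hR (hdeep v hv)).trans ?_
          exact mul_le_mul_of_nonneg_right
            (mul_le_mul_of_nonneg_right (le_abs_self C) (Real.rpow_nonneg hR0 _)) (mass_nonneg Λ u w v)
        rw [norm_mul]
        calc ‖(if v.2 = 0 then (1 : ℂ) else -1) * ψ v‖ * ‖dressedDefect Λ u w v‖
            ≤ 1 * (|C| * R ^ (-θ) * mass Λ u w v) :=
              mul_le_mul h1 h2 (norm_nonneg _) zero_le_one
          _ = |C| * R ^ (-θ) * mass Λ u w v := one_mul _
    _ = |C| * R ^ (-θ) * ∑ v ∈ S, mass Λ u w v := by rw [Finset.mul_sum]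
    _ ≤ |C| * (1 + L) * R ^ (-θ) * ∑ v ∈ S, mass Λ u w v := by
        have hM : 0 ≤ ∑ v ∈ S, mass Λ u w v :=
          Finset.sum_nonneg fun v _ => mass_nonneg Λ u w v
        have hfac : |C| * R ^ (-θ) ≤ |C| * (1 + L) * R ^ (-θ) := by
          have : |C| * R ^ (-θ) * 1 ≤ |C| * R ^ (-θ) * (1 + L) :=
            mul_le_mul_of_nonneg_left (by linarith) (mul_nonneg (abs_nonneg C) (Real.rpow_nonneg hR0 _))
          calc |C| * R ^ (-θ) = |C| * R ^ (-θ) * 1 := (mul_one _).symm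
            _ ≤ |C| * R ^ (-θ) * (1 + L) := this
            _ = |C| * (1 + L) * R ^ (-θ) := by ring
        exact mul_le_mul_of_nonneg_right hfac hM

/-- **(I5), lattice form — TARGET for a prover.**  `StaggeredDressedDecay → StaggeredCleanDecay` (with
`θ' = min θ 1`): apply `averaged_viaSum_identity` to the black part of `S` with weight `ψ` and to its white
neighbourhood with the neighbour-averaged weight, use `Ā_D = A_D + (Ā_D − A_D)`, subtract, and bound the
two `gradRem`s by `norm_gradRem_le` (`η = L/R`) and the weight discrepancies (neighbour averages vs `ψ`,
`card (star Λ t) = 3` at a `1`-deep `t` via `card_neighborSet_hexGraph_holds`) by `(L/R)·ΣM`: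
`(1 − q)·(staggered clean) = −(staggered dressed) + O((L/R)·ΣM)` over a support enlarged by two lattice
steps (still `R/2`-deep when `S` is `R`-deep and `R ≥ 4`). [folklore] -/
theorem staggeredCleanDecay_of_staggeredDressedDecay : StaggeredDressedDecay → StaggeredCleanDecay := by
  sorry

/-- **Weak synthesis — TARGET for a prover** (route-level, `WEAK-FORM.md` (C2)–(C3);
`--supports stmt-CriticalPhenomena-8551`): the node follows from winding rigidity, the positive mass
comparison and the STAGGERED CLEAN decay alone — no `DefectDecoherence`, no `U`/`S` star gradients, no
loop bound.  Proof plan (all ingredients landed or proved above): in the setting of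
`ConjugateClassNegligibleSynthesis.conjugateClassNegligible_of_cruxes`, regroup the finsum by black vertex
(`finsum_pairSet_eq`), split each star sum into `ψ(δc_b)·2T(b)` + Taylor term (`vertex_bound`'s `hsplit`;
Taylor part `≤ (Lip ψ · δ/2)·mass`), restrict the defect part to `B` = black vertices with `δc_b ∈ tsupport ψ`
(elsewhere `ψ(δc_b) = 0`), apply `averagedDefect_identity` on `B` (every `b ∈ B` is `r/(2δ)`-deep), bound
`gradRem` by `norm_gradRem_le` with `η = Lip ψ · δ`, rewrite the main term as the staggered clean sum over
`S = B ∪ W(B)` with the single weight `ψ̃ = ψ(δc_·)|_S / max ‖ψ‖∞ 1` (discrepancy with the neighbour-averaged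
white weight `≤ η·ΣM/2`, using `card (star Λ t) = 3`), apply the hypothesis with `R = r/(2δ)`,
`L = Lip ψ · r / 2`, bound `Σ_{S} M ≤ 2 ×` the mid-edge mass over `cthickening r (tsupport ψ)`
(`sum_pair_indicator_le_finsum` + its colour swap), and finish with `MassRatio` and rigidity exactly as in
the landed synthesis: total `O(δ^{θ−3/4} + δ^{1/4})·‖F_δ(b_δ)‖`. [folklore] -/
theorem conjugateClassNegligible_of_staggeredCleanDecay :
    BoundaryWindingRigidity → MassRatio → StaggeredCleanDecay → ConjugateClassNegligible := by
  sorry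

/-- The node from the staggered DRESSED decay (composition of the two targets). [folklore] -/
theorem conjugateClassNegligible_of_staggeredDressedDecay (hW : BoundaryWindingRigidity) (hM : MassRatio)
    (hD : StaggeredDressedDecay) : ConjugateClassNegligible :=
  conjugateClassNegligible_of_staggeredCleanDecay hW hM (staggeredCleanDecay_of_staggeredDressedDecay hD)

/-- Corollary: the node from the pointwise loop-dressed child (child `DressedDefectDecay` of the prepared
splits = the lead's registered `stub_dressedDefectDecay`). [folklore] -/
theorem conjugateClassNegligible_of_dressedDefectDecay (hW : BoundaryWindingRigidity) (hM : MassRatio)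
    (hD : DressedDefectDecay) : ConjugateClassNegligible :=
  conjugateClassNegligible_of_staggeredDressedDecay hW hM (staggeredDressedDecay_of_dressedDefectDecay hD)

end Summit.CriticalPhenomena.SAWScalingLimit.Cruxes.DefectDecoherence.WeakForm

end
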